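import Summits.BirchSwinnertonDyer.Rank1Residual.ManinAdditive.ConwayCut
import Summits.BirchSwinnertonDyer.Rank1Residual.ManinAdditive.ConwayNortonTwistAtThree
import Literature.NumberTheory.EllipticCurves.EichlerShimuraPeriods
import Literature.NumberTheory.EllipticCurves.NewformsOldNewProofs
import HarnessLib

/-!
# VISIBILITY AT 2: the mod-2 position of `E[2]` in `J₀(N)[2]` versus the Conway cut — E-desc-65 / E-desc-66 / P-desc-2
# (cell `bsd-f2-manin`; conjecture leaf typed by the typer g13 from planner desc g10's Sketch-desc-g10 512026bf7ceec595,
# T-desc-14, with refuter REF1 §R72 (HOME/ref1/R72-ref1-desc-g10.md 47431730e0f0af3b) folded)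

TYPER FRAMING.  Declarations VERBATIM from desc's sketch (namespace renamed `DescG10` → `TwoTorsionVisibility`); REF1 §R72
verdicts folded: E-desc-65 CHECKED / SURVIVES (census reproduced 262/262 by an independent Manin-symbol engine, law
«σ₂ = 1 ⟹ A = 1» 263/263, pre-registered core rows 528d1 / 832d1 / 912b1 ✓); E-desc-66 SURVIVES but is REDUNDANT — it follows
from E-desc-65 outright (REF1 kernel lemma A79.3, landed below as `conwayDefectTwoTorsionHalfOld_of_conwayFull`); P-desc-2 is
SETTLED = the tree theorem `Theorems.ManinLocalTwoThree.memConwayNortonLatticeAtThree_of_sameLevelTwist` (prover p2 g9, p644922)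
— its `_holds` is the sibling `TwoTorsionVisibilityHolds.lean` (conjecture-leaf convention).  REF1's sanity lemmas A79.1–A79.2
(`halfTranslate_two_eq`, `lowerHalfTranslate_def`, `homologyLattice_def`, `isNewformCycle_zero_left_iff`, `quarterOld_zero`,
`halfOld_zero`, `isNewformCycle_add/neg`, `quarterOld_witness_add_two`) are landed with attribution.  (α) membership rule
«x/2 ∈ B ⟺ x ∈ 2H + H ∩ V_B» and the Tate step: CORRECT (REF1 §R72 C); §27.8 (iii): `periodLatticeK 0` has index 1 in `H₁`.
Novelty (γ): new-combination (priors ARS 2011 Prop 2.3, CE 2009, Buzzard 2000 Thm 2.8, ARS 2006).  bears_on: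
stmt-BirchSwinnertonDyer-22967 (E-desc-65/66), stmt-BirchSwinnertonDyer-22968 (P-desc-2).  Nothing asserted beyond PROVED plumbing.

# Sketch-desc-g10 — VISIBILITY AT 2: the mod-2 POSITION of `E[2] = A_f[2]` in `J₀(N)[2]` versus the Conway cut
(cell `bsd-f2-manin`, planner `desc` g10, MEMO-desc §27; census HOME/desc/g10/VIS2-rows-g10.tsv, 262 optimal newforms
at the 94 levels `4 ∣ N ≤ 460` run in-seat; pre-registration HOME/desc/g10/predictions-g10.md d47a08f7da24fb8b).

THE OBJECTS (E-blind given the newform `f`; tree declarations only):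
* `H = H₁(X₀(N), ℤ)` realised as the Eichler–Shimura period lattice `periodLatticeK 0` inside `S₂(Γ₀(N))^∨`;
* the **`f`-cycles** `Λ_f = H ∩ V_f` (functionals in `H` vanishing on the Petersson = Hecke complement of `f`; for an
  optimal `f` this is `H₁(E^∨) ↪ H₁(J₀(N))`, and `x ↦ x/2` identifies `Λ_f/2Λ_f` with `E[2] ⊂ J₀(N)[2]`);
* the half-translation `t = t_{1/2}` (tree: `ConwayCut.halfTranslate`) and its conjugate `t' = (1 0; N/2 1) = w_N t w_N⁻¹`
  (`lowerHalfTranslate`), both automorphisms of `X₀(N)/ℚ` for `4 ∣ N`, acting on `H` by transpose;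
* `(J₀(N)^{t})⁰ = δ₂^* J₀(N/2)`, `(J₀(N)^{t'})⁰ = δ₁^* J₀(N/2)`, their intersection `O₁₂` (the part old from level `N/4`).
  For an abelian subvariety `B` with rational span `V_B`:  `x/2 ∈ B ⟺ x ∈ 2H + (H ∩ V_B)` (`H/(H ∩ V_B)` is torsion-free).
THE ROWS (candidate `Prop`s, `@[conjecture]`, nothing asserted):
* **E-desc-65 `ConwayFullOfTwoTorsionNotQuarterOld`**: if `E[2] ⊄ (δ₁^*J₀(N/2) ∩ δ₂^*J₀(N/2))⁰` then the Conway lattice has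
  FULL depth on the `f`-line (`σ₂ = 0`; with the GIVEN row E-desc-28♯ + `ConwayDepthTransfer`: `2 ∤ c_E` and Lie saturation
  at `2`).  Census: all 124 defect rows (`σ₂ = 1`) have `E[2] ⊂ O₁₂⁰`; equivalently all 89 rows with `E[2] ⊄ O₁₂⁰` are full —
  among them 16 of the 18 STARRED full rows, where every E-facing typing of g5–g9 failed (Φ-torsion core: 32a1, 56a1, 64a1,
  112b1, 192c1, 192d1 decided; 272c1 not).
* **E-desc-66 `ConwayDefectTwoTorsionHalfOld`** (the weaker one-operator shadow): `σ₂ = 1 ⟹ Λ_f ⊆ (t − 1)H`, i.e. `E[2] ⊂ δ₂^*J₀(N/2)`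
  (Tate: `π₀(J^t) = Ĥ⁰(⟨t⟩, J) ≅ Ĥ¹(⟨t⟩, H) = H^{t=−1}/(t−1)H`, and `t = −1` on `A_f` since newforms at `4 ∣ N` are 2-depleted).
  Census 124/124.
* support **P-desc-2 `MemConwayNortonOfSameLevelTwist`** (answer to prover-2's GAP NOTE on E-desc-52, MEMO-desc §25.2/§27.1):
  for a rational newform `f` whose `χ₋₃`-twist is again a newform of the same level, `f` and `f ⊗ χ₋₃` lie in the Conway–Norton
  lattice `M^G(N)` at 3 (the `ℤ[ζ₃]`-lattice `O(f+f')/2 ⊕ O(f−f')/2` is `⟨ζ₃, t_{1/3}, w_Q⟩`-stable: `A₃ f = (f'−f)/2`, `B₃ f = f'`).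
Near-law NOT filed (MEMO §27.5): «`σ₂ = 1 ⟺ starred ∧ E[2] ⊂ O₁₂⁰`» holds on 260/262 rows (exceptions 272c1, 416a1, both `I₀*`).
Beyond-print theorem: no. BSD is not proved by this; Manin's conjecture is not proved by this.
-/

noncomputable section

open scoped MatrixGroups ModularForm

open CongruenceSubgroup WeierstrassCurve Literature.NumberTheory.EllipticCurves.ModularForms
  Literature.NumberTheory.DiophantineGeometry

namespace Summit.BirchSwinnertonDyer.Rank1Residual.ManinAdditive.TwoTorsionVisibility

open ConwayCut ConwayNortonThree

/-! ### Homology as period functionals, the `f`-cycles, and the two half-translations -/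

section Objects

variable (N : ℕ) [NeZero N]

/-- `H = H₁(X₀(N), ℤ) ⊂ S₂(Γ₀(N))^∨`: the Eichler–Shimura period lattice of weight `2` (tree: `periodLatticeK 0`,
generated by the period functionals `f ↦ c_f(γ)(u,v)`, `γ ∈ Γ₀(N)`; Manin: `γ ↦ {τ, γτ}` maps `Γ₀(N)` onto `H₁`).
[cite: Shimura1971, §8.4 Prop. 8.6] -/
def homologyLattice : AddSubgroup (Module.Dual ℂ (CuspForm (Gamma0 N) 2)) :=
  periodLatticeK (N := N) 0

/-- The matrix `(1 0; N/2 1) ∈ GL(2, ℚ)⁺` (determinant `1`): `t' = w_N t_{1/2} w_N⁻¹` up to `Γ₀(N)`; it normalises `Γ₀(N)`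
iff `4 ∣ N`, and `X₀(N)/⟨t'⟩ ≅ X₀(N/2)` via `δ₁ : z ↦ z`. [folklore] -/
def lowerHalfTranslateGL : GL(2, ℚ)⁺ :=
  ⟨Matrix.GeneralLinearGroup.mkOfDetNeZero !![1, 0; (N : ℚ) / 2, 1] (by simp [Matrix.det_fin_two]),
    by simp [Matrix.det_fin_two]⟩

/-- The **lower half-translation** `t' f = f ∣ (1 0; N/2 1)` on `S_k(Γ₀(N))` (`4 ∣ N`; a single coset since the matrix
normalises `Γ₀(N)`; determinant `1`, so no scalar).  Junk (a genuine Hecke operator) if `4 ∤ N`. [folklore] -/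
def lowerHalfTranslate (k : ℤ) : CuspForm (Gamma0 N) k →ₗ[ℂ] CuspForm (Gamma0 N) k :=
  cuspHeckeOperatorₗ (Gamma0 N) k (lowerHalfTranslateGL N)

variable {N}

/-- The **`f`-cycles** `Λ_f = H ∩ V_f`: integral cycles whose period functional vanishes on the Petersson (= Hecke)
complement `f^⊥ = ker ⟨f, ·⟩`.  For a newform `f` with rational eigenvalues this is a rank-`2` lattice, the image of
`H₁(E_f^∨, ℤ)` in `H₁(J₀(N), ℤ)`; `Λ_f / 2Λ_f ≅ A_f[2]` via `x ↦ x/2`. [folklore] -/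
def IsNewformCycle (f : CuspForm (Gamma0 N) 2) (φ : Module.Dual ℂ (CuspForm (Gamma0 N) 2)) : Prop :=
  φ ∈ homologyLattice N ∧ ∀ g : CuspForm (Gamma0 N) 2, peterssonProductₗ (Gamma0 N) 2 f g = 0 → φ g = 0

/-- `E[2] ⊂ δ₂^* J₀(N/2) = (J₀(N)^{t})⁰`: every `f`-cycle is `2ψ + θ` with `ψ, θ ∈ H` and `θ` invariant under `t = t_{1/2}`
(equivalently, by Tate cohomology of `⟨t⟩` on `0 → H → H ⊗ ℝ → J → 0` and `t = −1` on `Λ_f`: `Λ_f ⊆ (t − 1)H`).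
E-blind; engine `vis2.py` column `in2 = 4`. [folklore] -/
def HalfOldVisibleTwoTorsion (N : ℕ) [NeZero N] (f : CuspForm (Gamma0 N) 2) : Prop :=
  ∀ φ, IsNewformCycle f φ → ∃ ψ ∈ homologyLattice N, ∃ θ ∈ homologyLattice N,
    θ ∘ₗ halfTranslate N 2 = θ ∧ φ = 2 • ψ + θ

/-- `E[2] ⊂ (δ₁^* J₀(N/2) ∩ δ₂^* J₀(N/2))⁰ =: O₁₂⁰` (the abelian subvariety old from level `N/4`): every `f`-cycle is
`2ψ + θ` with `ψ, θ ∈ H` and `θ` invariant under BOTH `t` and `t'`.  E-blind; engine column `A = 1`.  Strictly finer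
than `HalfOldVisibleTwoTorsion ∧ (its t'-version)`: `O₁ ∩ O₂` is disconnected in general (112b1, 192c1, 192d1:
`E[2] ⊂ O₁`, `E[2] ⊂ O₂`, `E[2] ⊄ O₁₂⁰`). [folklore] -/
def QuarterOldVisibleTwoTorsion (N : ℕ) [NeZero N] (f : CuspForm (Gamma0 N) 2) : Prop :=
  ∀ φ, IsNewformCycle f φ → ∃ ψ ∈ homologyLattice N, ∃ θ ∈ homologyLattice N,
    θ ∘ₗ halfTranslate N 2 = θ ∧ θ ∘ₗ lowerHalfTranslate N 2 = θ ∧ φ = 2 • ψ + θ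

end Objects

/-! ### Candidate laws (census = HOME/desc/g10/VIS2-rows-g10.tsv; nothing asserted) -/

section Laws

/-- **E-desc-65 `ConwayFullOfTwoTorsionNotQuarterOld`** (optimal `f`, `4 ∣ N`; E-blind hypothesis, census 89/89 full
rows with `E[2] ⊄ O₁₂⁰`, equivalently 124/124 defect rows have `E[2] ⊂ O₁₂⁰`; discovery `N ≤ 160` / validation
`160 < N ≤ 460` split pre-registered, validation 104/104 defect rows): if the 2-torsion of the optimal curve is NOT
inside the connected part of `δ₁^*J₀(N/2) ∩ δ₂^*J₀(N/2)`, the Conway-stable lattice has FULL depth on the `f`-line,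
`ord₂ [e_f S^G : ℤ f] = ord₂ deg φ` (so, modulo the GIVEN row E-desc-28♯ and `ConwayDepthTransfer`, `2 ∤ c_E` and
`E → J₀(N)` is Lie-saturated at `2`).  It decides 16 of the 18 starred full rows of the census (E-desc-31 decides the
identity-component-torsion ones; the union leaves 272c1 and 416a1).  Why it might fail: a starred curve whose degree
congruence is carried by NEW or odd-old forms only (so `E[2]` misses the `N/4`-old part) and is nevertheless destroyed by
`t`-instability of `S^{AL}` — none at `N ≤ 460`; the levels `464 ≤ N ≤ 612` and the core rows 456b1, 528d1, 656b1,
832d1, 912b1 are unrun (kit ask D-desc-11).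
[cite: Mazur1977, §II.7 (visibility of torsion in old subvarieties; shape only — the row is the cell's law E-desc-65, NOT in print; presearch MEMO-desc §27.7)] -/
@[conjecture]
def ConwayFullOfTwoTorsionNotQuarterOld : Prop :=
  ∀ (W : WeierstrassCurve ℚ) [W.IsElliptic] [W.IsGloballyMinimal] [NeZero (W.conductorNorm ℤ)]
    (D : ModularParametrizationData W (W.conductorNorm ℤ)),
    (∀ z ∈ D.L.lattice, ∃ w ∈ periodLattice D.f, z = D.c * w) →
    (∀ (W' : WeierstrassCurve ℚ) [W'.IsElliptic]
        (D' : ModularParametrizationData W' (W.conductorNorm ℤ)),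
        D'.f = D.f → D.modularDegree ≤ D'.modularDegree) →
    4 ∣ W.conductorNorm ℤ → ¬ QuarterOldVisibleTwoTorsion (W.conductorNorm ℤ) D.f →
      padicValNat 2 (lineIndex (conwayStableLattice (W.conductorNorm ℤ)) D.f) =
        padicValNat 2 D.modularDegree

/-- **E-desc-66 `ConwayDefectTwoTorsionHalfOld`** — REDUNDANT (REF1 §R72 A79.3): a COROLLARY of E-desc-65, see
`conwayDefectTwoTorsionHalfOld_of_conwayFull` below; kept as a named row for the census bookkeeping (optimal `f`, `4 ∣ N`; fully E-blind conclusion; census 124/124 defect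
rows, validation 104/104): a Conway DEFECT (`ord₂ [e_f S^G : ℤ f] < ord₂ deg φ`) forces `E[2] ⊂ δ₂^* J₀(N/2)`, i.e. every
`f`-cycle is `t`-exact modulo `2H`: the top `2`-adic congruence of `f` destroyed by the Conway cut is VISIBLE in the
`2`-old subvariety.  Why it might fail: a defect produced entirely by `w_{Q}`-non-integrality of `t`-translates of NEW
congruence partners; none at `N ≤ 460`.
[cite: Mazur1977, §II.7 (shape only — the row is the cell's law E-desc-66, NOT in print; presearch MEMO-desc §27.7)] -/
@[conjecture]
def ConwayDefectTwoTorsionHalfOld : Prop :=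
  ∀ (W : WeierstrassCurve ℚ) [W.IsElliptic] [W.IsGloballyMinimal] [NeZero (W.conductorNorm ℤ)]
    (D : ModularParametrizationData W (W.conductorNorm ℤ)),
    (∀ z ∈ D.L.lattice, ∃ w ∈ periodLattice D.f, z = D.c * w) →
    (∀ (W' : WeierstrassCurve ℚ) [W'.IsElliptic]
        (D' : ModularParametrizationData W' (W.conductorNorm ℤ)),
        D'.f = D.f → D.modularDegree ≤ D'.modularDegree) →
    4 ∣ W.conductorNorm ℤ →
    padicValNat 2 (lineIndex (conwayStableLattice (W.conductorNorm ℤ)) D.f) < padicValNat 2 D.modularDegree →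
      HalfOldVisibleTwoTorsion (W.conductorNorm ℤ) D.f ∧ QuarterOldVisibleTwoTorsion (W.conductorNorm ℤ) D.f

end Laws

/-! ### Support row for prover-2's GAP NOTE on E-desc-52 (MEMO-desc §25.2, §27.1) -/

/-- **P-desc-2 `MemConwayNortonOfSameLevelTwist`** — SETTLED (REF1 §R72 A79.4): this is the tree THEOREM
`Summit.BirchSwinnertonDyer.BirchSwinnertonDyer.Theorems.ManinLocalTwoThree.memConwayNortonLatticeAtThree_of_sameLevelTwist`
(prover p2 g9, p644922; `_holds` in the sibling `TwoTorsionVisibilityHolds.lean`) (theorem-candidate, `9 ∣ N`): if `f` is a newform with INTEGER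
coefficients and its `χ₋₃`-twist `f' = f ⊗ χ₋₃` is again a newform of level `N`, then `f, f' ∈ M^G(N)`: the
`ℤ[ζ₃]`-lattice `M₀ = O·(f+f')/2 ⊕ O·(f−f')/2 ≤ S₂(Γ₀(N);ℤ) ⊗ ℤ[ζ₃]` (`f ≡ f'` coefficientwise mod `2`) is stable under
`ζ₃`, every `w_{Q_p}` (both are newforms, hence `w_Q`-eigen: `IsNewform0.exists_atkinLehnerInvolutionAt_eq_smul`) and
`t_{1/3} = A₃ + ζ₃ B₃` (`A₃ f = (f'−f)/2`, `B₃ f = f'` by `twistOperatorEqCharTwist_holds`, `A₃ f' = (f−f')/2`, `B₃ f' = f`),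
so `M₀ ≤ M^G` by `le_sSup`.  Consequence for E-desc-52: `𝔟 = 𝔟' = ℤ[ζ₃]` in prover-2's notation, whence `|Δk| ≤ 1`
(census `Nb = 1` on 86/86 same-level rows, MEMO-desc §25.7 (v)).  Without the integrality hypothesis both `planeIndex`
values are the junk `0` and E-desc-52 holds trivially. [folklore] -/
def MemConwayNortonOfSameLevelTwist : Prop :=
  ∀ (N : ℕ) [NeZero N] (h9 : 3 ^ 2 ∣ N) (χ : DirichletCharacter ℂ 3) (hχ : χ.IsQuadratic), χ.IsPrimitive →
    ∀ f : CuspForm (Gamma0 N) 2, IsNewform0 f → IsNewform0 (charTwist N dvd_rfl h9 hχ f) →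
      (∀ n : ℕ, ∃ a : ℤ, cuspCoeff f n = a) →
      f ∈ conwayNortonLatticeAtThree N ∧ charTwist N dvd_rfl h9 hχ f ∈ conwayNortonLatticeAtThree N

/-! ### Elementary sanity lemmas (the predicates are not vacuous in the trivial direction) -/

/-- The zero functional is an `f`-cycle (so `IsNewformCycle f` is inhabited and the rows quantify over a nonempty set). -/
theorem isNewformCycle_zero {N : ℕ} [NeZero N] (f : CuspForm (Gamma0 N) 2) : IsNewformCycle f 0 :=
  ⟨AddSubgroup.zero_mem _, fun _ _ => rfl⟩

/-- `QuarterOldVisibleTwoTorsion → HalfOldVisibleTwoTorsion` (drop the `t'`-invariance). -/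
theorem halfOld_of_quarterOld {N : ℕ} [NeZero N] {f : CuspForm (Gamma0 N) 2}
    (h : QuarterOldVisibleTwoTorsion N f) : HalfOldVisibleTwoTorsion N f := by
  intro φ hφ
  obtain ⟨ψ, hψ, θ, hθ, ht, -, hsum⟩ := h φ hφ
  exact ⟨ψ, hψ, θ, hθ, ht, hsum⟩

/-! ### REF1 §R72 sanity lemmas A79.1–A79.3 (refuter-ref1 g10, HOME/ref1/ref1-C79-desc-g10-audit.lean; landed with attribution) -/

/-- A79.1a  At weight `2` the half-translation carries NO scalar: `4^{1 − 2/2} = 1`, so `θ ∘ₗ t = θ` in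
`HalfOldVisibleTwoTorsion` is invariance under the bare coset operator of `(2 1; 0 2)` (= `f(z + ½)`, Mathlib slash:
`det^{k−1} (cz+d)^{−k} = 4 · 2^{−2} = 1`). -/
theorem halfTranslate_weight_two_scalar : ((4 : ℝ) ^ (1 - ((2 : ℤ) : ℝ) / 2)) = 1 := by norm_num

/-- A79.1a (unfolding). -/
theorem halfTranslate_two_def (N : ℕ) [NeZero N] :
    halfTranslate N 2 =
      (((4 : ℝ) ^ (1 - ((2 : ℤ) : ℝ) / 2) : ℝ) : ℂ) • cuspHeckeOperatorₗ (Gamma0 N) 2 halfTranslateGL := rfl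

/-- A79.1a  `halfTranslate N 2` is the bare coset operator of `(2 1; 0 2)`. -/
theorem halfTranslate_two_eq (N : ℕ) [NeZero N] :
    halfTranslate N 2 = cuspHeckeOperatorₗ (Gamma0 N) 2 halfTranslateGL := by
  rw [halfTranslate_two_def, halfTranslate_weight_two_scalar]; simp

/-- A79.1b  `t'` is the bare coset operator of `(1 0; N/2 1)` (determinant `1`, no scalar at any weight). -/
theorem lowerHalfTranslate_def (N : ℕ) [NeZero N] (k : ℤ) :
    lowerHalfTranslate N k = cuspHeckeOperatorₗ (Gamma0 N) k (lowerHalfTranslateGL N) := rfl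

/-- A79.1c  `H` is LITERALLY the tree's weight-2 Eichler–Shimura period lattice `periodLatticeK 0`. -/
theorem homologyLattice_def (N : ℕ) [NeZero N] : homologyLattice N = periodLatticeK (N := N) 0 := rfl

/-- A79.2a  Junk direction `f = 0`: the only `0`-cycle condition is `φ = 0` on top of `φ ∈ H` (the Petersson
hypothesis `⟨0, g⟩ = 0` is always met), so both predicates hold at `f = 0` for the trivial reason.  In the rows
`f = D.f` is a newform, so this junk is not reachable there. -/
theorem isNewformCycle_zero_left_iff (N : ℕ) [NeZero N] (φ : Module.Dual ℂ (CuspForm (Gamma0 N) 2)) :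
    IsNewformCycle (0 : CuspForm (Gamma0 N) 2) φ ↔ φ ∈ homologyLattice N ∧ φ = 0 := by
  constructor
  · rintro ⟨h, h0⟩
    refine ⟨h, ?_⟩
    ext g
    simpa using h0 g (by simp [peterssonProduct_zero_left])
  · rintro ⟨h, rfl⟩
    exact ⟨h, fun _ _ => rfl⟩

/-- A79.2a  junk direction `f = 0`. -/
theorem quarterOld_zero (N : ℕ) [NeZero N] : QuarterOldVisibleTwoTorsion N 0 := by
  intro φ hφ
  obtain ⟨-, rfl⟩ := (isNewformCycle_zero_left_iff N φ).1 hφ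
  exact ⟨0, zero_mem _, 0, zero_mem _, by simp, by simp, by simp⟩

/-- A79.2a  junk direction `f = 0`. -/
theorem halfOld_zero (N : ℕ) [NeZero N] : HalfOldVisibleTwoTorsion N 0 :=
  halfOld_of_quarterOld (quarterOld_zero N)

/-- A79.2b  The `f`-cycles form a subgroup of `H` (closed under `+` and `−`), as `Λ_f = H ∩ V_f` must be. -/
theorem isNewformCycle_add {N : ℕ} [NeZero N] {f : CuspForm (Gamma0 N) 2}
    {φ ψ : Module.Dual ℂ (CuspForm (Gamma0 N) 2)} (hφ : IsNewformCycle f φ) (hψ : IsNewformCycle f ψ) :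
    IsNewformCycle f (φ + ψ) :=
  ⟨add_mem hφ.1 hψ.1, fun g hg => by simp [hφ.2 g hg, hψ.2 g hg]⟩

/-- A79.2b (negation). -/
theorem isNewformCycle_neg {N : ℕ} [NeZero N] {f : CuspForm (Gamma0 N) 2}
    {φ : Module.Dual ℂ (CuspForm (Gamma0 N) 2)} (hφ : IsNewformCycle f φ) : IsNewformCycle f (-φ) :=
  ⟨neg_mem hφ.1, fun g hg => by simp [hφ.2 g hg]⟩

/-- A79.2c  `2H`-translates are harmless: if every `f`-cycle is quarter-old visible then so is every `f`-cycle plus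
`2χ`, `χ ∈ H` (the predicates only see `Λ_f` modulo `2H`, i.e. `E[2]`). -/
theorem quarterOld_witness_add_two {N : ℕ} [NeZero N]
    {φ χ : Module.Dual ℂ (CuspForm (Gamma0 N) 2)} (hχ : χ ∈ homologyLattice N)
    (h : ∃ ψ ∈ homologyLattice N, ∃ θ ∈ homologyLattice N,
      θ ∘ₗ halfTranslate N 2 = θ ∧ θ ∘ₗ lowerHalfTranslate N 2 = θ ∧ φ = 2 • ψ + θ) :
    ∃ ψ ∈ homologyLattice N, ∃ θ ∈ homologyLattice N,
      θ ∘ₗ halfTranslate N 2 = θ ∧ θ ∘ₗ lowerHalfTranslate N 2 = θ ∧ φ + 2 • χ = 2 • ψ + θ := by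
  obtain ⟨ψ, hψ, θ, hθ, ht, ht', rfl⟩ := h
  exact ⟨ψ + χ, add_mem hψ hχ, θ, hθ, ht, ht', by rw [smul_add]; abel⟩

/-- A79.3  **E-desc-66 follows from E-desc-65 outright** (same binders; a strict defect contradicts the equality that
E-desc-65 yields from `¬ QuarterOld…`, so `QuarterOld…` holds classically, and `HalfOld…` by `halfOld_of_quarterOld`).
So E-desc-66 is not an independent row: it is the contrapositive shadow of E-desc-65 (its `HalfOld` conjunct is implied
by its `QuarterOld` conjunct). -/
theorem conwayDefectTwoTorsionHalfOld_of_conwayFull :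
    ConwayFullOfTwoTorsionNotQuarterOld → ConwayDefectTwoTorsionHalfOld := by
  intro h W _ _ _ D hL hopt h4 hlt
  have hq : QuarterOldVisibleTwoTorsion (W.conductorNorm ℤ) D.f := by
    by_contra hnq
    exact absurd (h W D hL hopt h4 hnq) (ne_of_lt hlt)
  exact ⟨halfOld_of_quarterOld hq, hq⟩

end Summit.BirchSwinnertonDyer.Rank1Residual.ManinAdditive.TwoTorsionVisibility
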